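import Mathlib
import Summits.Ventures.PercRepro2.HCov
import Summits.Ventures.PercRepro2.HCovSwap
import Summits.Ventures.PercRepro2.A3RootEdge
import Summits.Ventures.PercRepro2.A3RootEdgeAll
import Summits.Ventures.PercRepro2.EdgeCubic
import Summits.Ventures.PercRepro2.EdgeCubicAll
import Summits.Ventures.PercRepro2.RootEdgeBern
import Summits.Ventures.PercRepro2.RootEdgeBernSwap
import Summits.Ventures.PercRepro2.CPolarA3
import Summits.Ventures.PercRepro2.CPolarA3Marks
import Summits.Ventures.PercRepro2.PendantA3Pins
import Summits.Ventures.PercRepro2.PendantClusterPins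
import Summits.Ventures.PercRepro2.PendantClusterMasses
import Summits.Ventures.PercRepro2.PendantClusterBern
import Summits.Ventures.PercRepro2.ClusterRootPins
import Summits.Ventures.PercRepro2.ClusterRootBern
import Summits.Ventures.PercRepro2.EdgeReloc
import Summits.Ventures.PercRepro2.ReachRootEdge
import Summits.Ventures.PercRepro2.CPolarSub

/-!
# (SUB) HOLDS ON EVERY EDGE CLASS WHERE ROW 2′CPOLAR IS A THEOREM (blind cell PercRepro2, p5 g16;
`proofs/P5-OEDGE.md` §20)

The unified per-edge target `Sub1 ∧ Sub2` of CPolarSub.lean — the one-edge Bernstein coefficients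
bounded below by the CLOSED pin's slack alone — is not just consistent with the known classes, it is
implied by their landed identities:

* at a literal root edge `{a₁, a₃}` (RootEdgeBern.lean: `Q₀Q₁·B1 = Q₁²·Gc₀ + D₀Q₀²·g₁ + df·dg`,
  `B2 = D₀·g₁`, `D₁ = 0`) both hold UNCONDITIONALLY (**`sub1_root`**, **`sub2_root`**, the `a₂` side by
  the root swap, **`sub_of_isRootEdge`**);
* at a cluster-root edge `{a₁, z}`, `z` in the reach of `a₃` (ClusterRootBern.lean's almost-sure
  twins) likewise (**`sub_of_isClusterRootEdge`**), and at a reach-root edge by relocation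
  (**`sub_of_isReachRootEdge`**);
* at the single fractional boundary edge of a mark-free pendant `a₃`-cluster with a positively
  correlated attachment (PendantClusterBern.lean's identities `Q·D·B1 = Q·D·Gc₀ + D²·Gc₀ + Q²·Gc₁ +
  Q·(Qo·D − Q·Do)·(Ŝ − D·Qb)`, its `B2` twin) they hold given (HCOV) at the OPEN pin only
  (**`sub_of_pendantPA`**) — the closed pin's slack is indeed not used.

So the open statement of the CPOLAR road, `CPolarA3Sub_all`, asks (SUB) exactly where nothing is
known: the contracted `o`-edges, the `b`-edges and the unmarked `a₃`-edges of degree ≥ 2, and the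
pendant edges at negatively correlated attachments.
-/

namespace Summit.Ventures.PercRepro2

open UnionCluster CovForm CovForm.CPolarA3 CovForm.RootEdge PendantA3 PendantCluster ClusterRoot
  ReachRoot EdgeReloc CPolarSub

namespace CPolarSubClasses

open EdgeLine

/-! ## The root swap -/

section Swap

variable {V : Type*} {E : Type*} [Fintype E] [DecidableEq E] {R : Type*} [Field R]
  [LinearOrder R]

/-- `Sub1` is symmetric in the roots. -/
theorem Sub1_swap (p : E → R) (ends : E → Sym2 V) (o a₁ a₂ a₃ b : V) (e : E) :
    Sub1 p ends o a₂ a₁ a₃ b e ↔ Sub1 p ends o a₁ a₂ a₃ b e := by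
  unfold Sub1
  rw [avoidAll_root_swap, PDEvent_root_swap, Gc_swap, B1_swap]

/-- `Sub2` is symmetric in the roots. -/
theorem Sub2_swap (p : E → R) (ends : E → Sym2 V) (o a₁ a₂ a₃ b : V) (e : E) :
    Sub2 p ends o a₂ a₁ a₃ b e ↔ Sub2 p ends o a₁ a₂ a₃ b e := by
  unfold Sub2
  rw [avoidAll_root_swap, PDEvent_root_swap, Gc_swap, B2_swap]

end Swap

/-! ## Literal root edges -/

section Root

variable {V : Type*} {E : Type*} [Fintype V] [DecidableEq V] [Fintype E] [DecidableEq E]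
  {R : Type*} [Field R] [LinearOrder R] [IsStrictOrderedRing R]

variable {ends : E → Sym2 V} {e : E} {a₁ a₃ : V}

/-- **`Sub2` at a root edge `{a₁, a₃}`**, unconditionally (`D₁ = 0`, `B2 ≥ 0`). -/
theorem sub2_root (p : E → R) (hp : IsProbVec p) (hends : ends e = s(a₁, a₃)) (o a₂ b : V) :
    Sub2 p ends o a₁ a₂ a₃ b e := by
  unfold Sub2
  rw [prob_one_PD p hends a₂, mul_zero, zero_mul]
  have hp₀ : IsProbVec (Function.update p e 0) := hp.update e le_rfl zero_le_one
  exact mul_nonneg (mul_nonneg (prob_nonneg hp₀ _) (prob_nonneg hp₀ _))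
    (B2_nonneg_root p hp hends o a₂ b)

/-- **`Sub1` at a root edge `{a₁, a₃}`**, unconditionally: `Q₀Q₁·B1 − Q₁²·Gc₀ = D₀Q₀²·g₁ + df·dg ≥ 0`. -/
theorem sub1_root (p : E → R) (hp : IsProbVec p) (hends : ends e = s(a₁, a₃)) (o a₂ b : V) :
    Sub1 p ends o a₁ a₂ a₃ b e := by
  unfold Sub1
  rw [prob_one_PD p hends a₂, mul_zero, add_zero]
  have hp₀ : IsProbVec (Function.update p e 0) := hp.update e le_rfl zero_le_one
  have hp₁ : IsProbVec (Function.update p e 1) := hp.update e zero_le_one le_rfl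
  have hQ0 := prob_nonneg hp₀ (avoidAll ends a₂ {a₁})
  have hQ1 := prob_nonneg hp₁ (avoidAll ends a₂ {a₁})
  have hD := prob_nonneg hp₀ (PDEvent ends a₁ a₂ a₃)
  rcases eq_or_lt_of_le hQ1 with hz | hpos1
  · rw [B1_eq_zero_of_Q_eq_zero p hp hends o a₂ b (Or.inr hz.symm), ← hz]
    simp
  have key := B1_eq_root p hends o a₂ b
  have hg := g1_nonneg (Function.update p e 1) hp₁ ends o a₁ a₂ b
  have hdf := dfc_nonneg p hp ends a₁ a₂ a₃ b e hends
  have hdg := dgc_nonneg p hp ends o a₁ a₂ a₃ e hends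
  -- `Q₁²·Gc₀ ≤ Q₀Q₁·B1`
  have hkey : prob (Function.update p e 1) (avoidAll ends a₂ {a₁}) ^ 2 *
      Gc (Function.update p e 0) ends o a₁ a₂ a₃ b ≤
      prob (Function.update p e 0) (avoidAll ends a₂ {a₁}) *
        prob (Function.update p e 1) (avoidAll ends a₂ {a₁}) * B1 p ends o a₁ a₂ a₃ b e := by
    rw [key]
    linarith [mul_nonneg (mul_nonneg hD (pow_nonneg hQ0 2)) hg, mul_nonneg hdf hdg]
  -- multiply by `D₀ ≥ 0`, divide by `Q₁ > 0`
  have h2 := mul_le_mul_of_nonneg_left hkey hD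
  refine le_of_mul_le_mul_left ?_ hpos1
  nlinarith [h2]

/-- **(SUB) at every literal root edge at `a₃`**, unconditionally. -/
theorem sub_of_isRootEdge (p : E → R) (hp : IsProbVec p) (o a₁ a₂ a₃ b : V) (e : E)
    (he : IsRootEdge ends a₁ a₂ a₃ e) :
    Sub1 p ends o a₁ a₂ a₃ b e ∧ Sub2 p ends o a₁ a₂ a₃ b e := by
  rcases he with h | h | h | h
  · exact ⟨sub1_root p hp h o a₂ b, sub2_root p hp h o a₂ b⟩
  · exact ⟨sub1_root p hp (by rw [h, Sym2.eq_swap]) o a₂ b,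
      sub2_root p hp (by rw [h, Sym2.eq_swap]) o a₂ b⟩
  · exact ⟨(Sub1_swap p ends o a₁ a₂ a₃ b e).1 (sub1_root p hp h o a₁ b),
      (Sub2_swap p ends o a₁ a₂ a₃ b e).1 (sub2_root p hp h o a₁ b)⟩
  · exact ⟨(Sub1_swap p ends o a₁ a₂ a₃ b e).1 (sub1_root p hp (by rw [h, Sym2.eq_swap]) o a₁ b),
      (Sub2_swap p ends o a₁ a₂ a₃ b e).1 (sub2_root p hp (by rw [h, Sym2.eq_swap]) o a₁ b)⟩

end Root

/-! ## Cluster-root and reach-root edges -/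

section Cluster

variable {V : Type*} {E : Type*} [Fintype V] [DecidableEq V] [Fintype E] [DecidableEq E]
  {R : Type*} [Field R] [LinearOrder R] [IsStrictOrderedRing R]

variable {ends : E → Sym2 V} {e : E} {a₁ a₃ z : V}

/-- **`Sub2` at a cluster-root edge `{a₁, z}`**, unconditionally. -/
theorem sub2_cluster_root (p : E → R) (hp : IsProbVec p) (hends : ends e = s(a₁, z))
    (hz : z ∈ pinnedReach p ends a₃) (o a₂ b : V) : Sub2 p ends o a₁ a₂ a₃ b e := by
  unfold Sub2
  rw [prob_one_PD_ae p a₂ hends hz, mul_zero, zero_mul]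
  have hp₀ : IsProbVec (Function.update p e 0) := hp.update e le_rfl zero_le_one
  exact mul_nonneg (mul_nonneg (prob_nonneg hp₀ _) (prob_nonneg hp₀ _))
    (B2_nonneg_cluster_root p hp hends hz o a₂ b)

/-- **`Sub1` at a cluster-root edge `{a₁, z}`** (`e` fractional), unconditionally. -/
theorem sub1_cluster_root (p : E → R) (hp : IsProbVec p) (hends : ends e = s(a₁, z))
    (hz : z ∈ pinnedReach p ends a₃) (hf1 : p e ≠ 1) (o a₂ b : V) :
    Sub1 p ends o a₁ a₂ a₃ b e := by
  unfold Sub1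
  rw [prob_one_PD_ae p a₂ hends hz, mul_zero, add_zero]
  have hp₀ : IsProbVec (Function.update p e 0) := hp.update e le_rfl zero_le_one
  have hp₁ : IsProbVec (Function.update p e 1) := hp.update e zero_le_one le_rfl
  have hQ0 := prob_nonneg hp₀ (avoidAll ends a₂ {a₁})
  have hQ1 := prob_nonneg hp₁ (avoidAll ends a₂ {a₁})
  have hD := prob_nonneg hp₀ (PDEvent ends a₁ a₂ a₃)
  rcases eq_or_lt_of_le hQ1 with hzero | hpos1
  · rw [B1_eq_zero_of_Q_eq_zero_cluster p hp hends hz o a₂ b (Or.inr hzero.symm), ← hzero]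
    simp
  have key := B1_eq_cluster_root p hends hz o a₂ b
  have hg := g1_nonneg (Function.update p e 1) hp₁ ends o a₁ a₂ b
  have hdf := dfc_nonneg p hp ends a₁ a₂ z b e hends
  have hdg := dgc_nonneg p hp ends o a₁ a₂ z e hends
  rw [Do_zero_z_eq p a₂ hz hf1 o, prob_zero_PD_z p a₂ hz hf1, DEF_zero_z_eq p a₂ hz hf1 o] at hdg
  have hkey : prob (Function.update p e 1) (avoidAll ends a₂ {a₁}) ^ 2 *
      Gc (Function.update p e 0) ends o a₁ a₂ a₃ b ≤
      prob (Function.update p e 0) (avoidAll ends a₂ {a₁}) *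
        prob (Function.update p e 1) (avoidAll ends a₂ {a₁}) * B1 p ends o a₁ a₂ a₃ b e := by
    rw [key]
    linarith [mul_nonneg (mul_nonneg hD (pow_nonneg hQ0 2)) hg, mul_nonneg hdf hdg]
  have h2 := mul_le_mul_of_nonneg_left hkey hD
  refine le_of_mul_le_mul_left ?_ hpos1
  nlinarith [h2]

/-- **(SUB) at every fractional cluster-root edge**, unconditionally. -/
theorem sub_of_isClusterRootEdge (p : E → R) (hp : IsProbVec p) (o a₁ a₂ a₃ b : V) (e : E)
    (he : IsClusterRootEdge p ends a₁ a₂ a₃ e) (hf1 : p e ≠ 1) :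
    Sub1 p ends o a₁ a₂ a₃ b e ∧ Sub2 p ends o a₁ a₂ a₃ b e := by
  obtain ⟨z, hz, h | h | h | h⟩ := he
  · exact ⟨sub1_cluster_root p hp h hz hf1 o a₂ b, sub2_cluster_root p hp h hz o a₂ b⟩
  · exact ⟨sub1_cluster_root p hp (by rw [h, Sym2.eq_swap]) hz hf1 o a₂ b,
      sub2_cluster_root p hp (by rw [h, Sym2.eq_swap]) hz o a₂ b⟩
  · exact ⟨(Sub1_swap p ends o a₁ a₂ a₃ b e).1 (sub1_cluster_root p hp h hz hf1 o a₁ b),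
      (Sub2_swap p ends o a₁ a₂ a₃ b e).1 (sub2_cluster_root p hp h hz o a₁ b)⟩
  · exact ⟨(Sub1_swap p ends o a₁ a₂ a₃ b e).1
        (sub1_cluster_root p hp (by rw [h, Sym2.eq_swap]) hz hf1 o a₁ b),
      (Sub2_swap p ends o a₁ a₂ a₃ b e).1
        (sub2_cluster_root p hp (by rw [h, Sym2.eq_swap]) hz o a₁ b)⟩

/-- (SUB) transfers along the relocation of the edge's own end `u` to the root `r`. -/
theorem sub_reach_root (p : E → R) (hp : IsProbVec p) (o a₁ a₂ a₃ b r u : V)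
    (hr : r = a₁ ∨ r = a₂) (hu : u ∈ pinnedReach p ends r) (hz : z ∈ pinnedReach p ends a₃)
    (he : ends e = s(u, z)) (hf1 : p e ≠ 1) :
    Sub1 p ends o a₁ a₂ a₃ b e ∧ Sub2 p ends o a₁ a₂ a₃ b e := by
  set ends' := Function.update ends e s(r, z) with hends'
  have hH₀ : ∀ ω, weight (Function.update p e 0) ω ≠ 0 →
      ∀ x y, Conn ends ω x y ↔ Conn ends' ω x y :=
    fun ω hw x y => conn_reloc_iff_ae (update_agree_off p e 0) hf1 hu he hw x y
  have hH₁ : ∀ ω, weight (Function.update p e 1) ω ≠ 0 →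
      ∀ x y, Conn ends ω x y ↔ Conn ends' ω x y :=
    fun ω hw x y => conn_reloc_iff_ae (update_agree_off p e 1) hf1 hu he hw x y
  have hz' : z ∈ pinnedReach p ends' a₃ := by rw [hends', pinnedReach_reloc p hf1]; exact hz
  have hcr : IsClusterRootEdge p ends' a₁ a₂ a₃ e := by
    refine ⟨z, hz', ?_⟩
    rcases hr with rfl | rfl
    · exact Or.inl (Function.update_self e _ ends)
    · exact Or.inr (Or.inr (Or.inl (Function.update_self e _ ends)))
  obtain ⟨h1, h2⟩ := sub_of_isClusterRootEdge p hp o a₁ a₂ a₃ b e hcr hf1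
  constructor
  · unfold Sub1 at h1 ⊢
    rw [prob_Q hH₁, prob_PD hH₀, prob_Q hH₀, prob_PD hH₁, Gc_congr hH₀, B1_congr hH₀ hH₁]
    exact h1
  · unfold Sub2 at h2 ⊢
    rw [prob_Q hH₁, prob_PD hH₁, prob_Q hH₀, prob_PD hH₀, Gc_congr hH₀, B2_congr hH₀ hH₁]
    exact h2

/-- **(SUB) at every fractional reach-root edge**, unconditionally. -/
theorem sub_of_isReachRootEdge (p : E → R) (hp : IsProbVec p) (o a₁ a₂ a₃ b : V) (e : E)
    (he : IsReachRootEdge p ends a₁ a₂ a₃ e) (hf1 : p e ≠ 1) :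
    Sub1 p ends o a₁ a₂ a₃ b e ∧ Sub2 p ends o a₁ a₂ a₃ b e := by
  obtain ⟨z, hz, u, hu, hends | hends⟩ := he
  · rcases hu with hu | hu
    · exact sub_reach_root p hp o a₁ a₂ a₃ b a₁ u (Or.inl rfl) hu hz hends hf1
    · exact sub_reach_root p hp o a₁ a₂ a₃ b a₂ u (Or.inr rfl) hu hz hends hf1
  · have hends' : ends e = s(u, z) := by rw [hends, Sym2.eq_swap]
    rcases hu with hu | hu
    · exact sub_reach_root p hp o a₁ a₂ a₃ b a₁ u (Or.inl rfl) hu hz hends' hf1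
    · exact sub_reach_root p hp o a₁ a₂ a₃ b a₂ u (Or.inr rfl) hu hz hends' hf1

end Cluster

/-! ## Pendant-PA edges -/

section Pendant

variable {R : Type*} [Field R]

/-- The polynomial identity behind `Sub1` at a pendant edge:
`D·(Q²·B1 − (Q² + QD)·Gc₀) = Q³·Gc₁ + Q²·(Qo·D − Q·Do)·(Ŝ − D·Qb)` (pure `ring`). -/
lemma sub1Poly_pendant (Q gap EQbo EQo Qo Qb Qbo D Do EQb3 EQb3o EQ3 EQ3o PDb PDbo : R) :
    D * (Q * Q * B1Poly Q Q Qo EQbo 0 0 EQo 0 0 Qb Qbo gap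
        Q D Do EQbo EQb3 EQb3o EQo EQ3 EQ3o PDb PDbo gap -
      (Q * Q + Q * D) * GcPoly Q Q Qo EQbo 0 0 EQo 0 0 Qb Qbo gap) =
    Q * Q * Q * GcPoly Q D Do EQbo EQb3 EQb3o EQo EQ3 EQ3o PDb PDbo gap +
      Q * Q * ((Qo * D - Q * Do) * (Q * EQb3 + gap * EQ3 + Q * PDb - D * Qb)) := by
  unfold B1Poly GcPoly polar1
  ring

/-- The polynomial identity behind `Sub2` at a pendant edge:
`D·(Q²·B2 − QD·Gc₀) = Q²D·Gc₁ + Q³·Gc₁ + Q²·(Qo·D − Q·Do)·(Ŝ − D·Qb)` (pure `ring`). -/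
lemma sub2Poly_pendant (Q gap EQbo EQo Qo Qb Qbo D Do EQb3 EQb3o EQ3 EQ3o PDb PDbo : R) :
    D * (Q * Q * B2Poly Q Q Qo EQbo 0 0 EQo 0 0 Qb Qbo gap
        Q D Do EQbo EQb3 EQb3o EQo EQ3 EQ3o PDb PDbo gap -
      Q * D * GcPoly Q Q Qo EQbo 0 0 EQo 0 0 Qb Qbo gap) =
    Q * Q * D * GcPoly Q D Do EQbo EQb3 EQb3o EQo EQ3 EQ3o PDb PDbo gap +
      Q * Q * Q * GcPoly Q D Do EQbo EQb3 EQb3o EQo EQ3 EQ3o PDb PDbo gap +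
      Q * Q * ((Qo * D - Q * Do) * (Q * EQb3 + gap * EQ3 + Q * PDb - D * Qb)) := by
  unfold B2Poly GcPoly polar2
  ring

variable {V : Type*} {E : Type*} [Fintype V] [DecidableEq V] [Fintype E] [DecidableEq E]
  [LinearOrder R] [IsStrictOrderedRing R]

/-- **(SUB) at the single fractional boundary edge of a mark-free pendant `a₃`-cluster with a
positively correlated attachment, given (HCOV) at the OPEN pin only.** -/
theorem sub_of_pendant (p : E → R) (hp : IsProbVec p) {ends : E → Sym2 V} {f : E}
    {o a₁ a₂ a₃ b z u : V} (hK : ∀ e ∈ fracEdges p, TouchesReach p ends a₃ e → e = f)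
    (hf : ends f = s(z, u)) (hz : z ∈ pinnedReach p ends a₃) (hu : u ∉ pinnedReach p ends a₃)
    (hf1 : p f ≠ 1) (h1 : a₁ ∉ pinnedReach p ends a₃) (h2 : a₂ ∉ pinnedReach p ends a₃)
    (ho : o ∉ pinnedReach p ends a₃) (hb : b ∉ pinnedReach p ends a₃)
    (hD : 0 < prob p (PDEvent ends a₁ a₂ u))
    (h₁ : HCov (Function.update p f 1) ends o a₁ a₂ a₃ b)
    (hcov : prob p (avoidAll ends a₂ {a₁}) * Do p ends o a₁ a₂ u ≤
      (prob p (avoidAll ends a₂ {a₁} ∩ connEvent ends a₁ o) +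
        prob p (avoidAll ends a₂ {a₁} ∩ connEvent ends a₂ o)) * prob p (PDEvent ends a₁ a₂ u)) :
    Sub1 p ends o a₁ a₂ a₃ b f ∧ Sub2 p ends o a₁ a₂ a₃ b f := by
  obtain ⟨hQ0, hD0, hDo0, hEQbo0, hEQb3_0, hEQb3o0, hEQo0, hEQ3_0, hEQ3o0, hPDb0, hPDbo0, hgap0⟩ :=
    pins_zero_cluster p hK hf hz hu hf1 h1 h2 ho hb
  obtain ⟨hQ1, hD1, hDo1, hEQbo1, hEQb3_1, hEQb3o1, hEQo1, hEQ3_1, hEQ3o1, hPDb1, hPDbo1, hgap1⟩ :=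
    pins_one_cluster p hK hf hz hu hf1 h1 h2 ho hb
  unfold HCov at h₁
  rw [Gc_eq_GcPoly] at h₁
  rw [hQ1, hD1, hDo1, hEQbo1, hEQb3_1, hEQb3o1, hEQo1, hEQ3_1, hEQ3o1, hPDb1, hPDbo1, hgap1] at h₁
  have hQ : 0 ≤ prob p (avoidAll ends a₂ {a₁}) := prob_nonneg hp _
  have hsl := slack_nonneg p hp ends a₁ a₂ u b
  have hcov' : 0 ≤ (prob p (avoidAll ends a₂ {a₁} ∩ connEvent ends a₁ o) +
      prob p (avoidAll ends a₂ {a₁} ∩ connEvent ends a₂ o)) * prob p (PDEvent ends a₁ a₂ u) -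
      prob p (avoidAll ends a₂ {a₁}) * Do p ends o a₁ a₂ u := sub_nonneg.2 hcov
  constructor
  · unfold Sub1
    rw [Gc_eq_GcPoly]
    unfold B1
    rw [hQ0, hD0, hDo0, hEQbo0, hEQb3_0, hEQb3o0, hEQo0, hEQ3_0, hEQ3o0, hPDb0, hPDbo0, hgap0,
      hQ1, hD1, hDo1, hEQbo1, hEQb3_1, hEQb3o1, hEQo1, hEQ3_1, hEQ3o1, hPDb1, hPDbo1, hgap1]
    have key := sub1Poly_pendant (prob p (avoidAll ends a₂ {a₁})) (gap p ends a₁ a₂ b)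
      (EQbo p ends o a₁ a₂ b) (EQo p ends o a₁ a₂)
      (prob p (avoidAll ends a₂ {a₁} ∩ connEvent ends a₁ o) +
        prob p (avoidAll ends a₂ {a₁} ∩ connEvent ends a₂ o))
      (prob p (avoidAll ends a₂ {a₁} ∩ connEvent ends a₁ b) +
        prob p (avoidAll ends a₂ {a₁} ∩ connEvent ends a₂ b))
      (prob p (avoidAll ends a₂ {a₁} ∩ (connEvent ends a₁ o ∩ connEvent ends a₁ b)) +
        prob p (avoidAll ends a₂ {a₁} ∩ (connEvent ends a₂ o ∩ connEvent ends a₁ b)) +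
        prob p (avoidAll ends a₂ {a₁} ∩ (connEvent ends a₁ o ∩ connEvent ends a₂ b)) +
        prob p (avoidAll ends a₂ {a₁} ∩ (connEvent ends a₂ o ∩ connEvent ends a₂ b)))
      (prob p (PDEvent ends a₁ a₂ u)) (Do p ends o a₁ a₂ u) (EQb3 p ends a₁ a₂ u b)
      (EQb3o p ends o a₁ a₂ u b) (EQ3 p ends a₁ a₂ u) (EQ3o p ends o a₁ a₂ u)
      (PDb p ends a₁ a₂ u b) (PDbo p ends o a₁ a₂ u b)
    have hr := add_nonneg (mul_nonneg (mul_nonneg (mul_nonneg hQ hQ) hQ) h₁)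
      (mul_nonneg (mul_nonneg hQ hQ) (mul_nonneg hcov' hsl))
    rw [← key] at hr
    exact sub_nonneg.1 ((mul_nonneg_iff_of_pos_left hD).1 hr)
  · unfold Sub2
    rw [Gc_eq_GcPoly]
    unfold B2
    rw [hQ0, hD0, hDo0, hEQbo0, hEQb3_0, hEQb3o0, hEQo0, hEQ3_0, hEQ3o0, hPDb0, hPDbo0, hgap0,
      hQ1, hD1, hDo1, hEQbo1, hEQb3_1, hEQb3o1, hEQo1, hEQ3_1, hEQ3o1, hPDb1, hPDbo1, hgap1]
    have key := sub2Poly_pendant (prob p (avoidAll ends a₂ {a₁})) (gap p ends a₁ a₂ b)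
      (EQbo p ends o a₁ a₂ b) (EQo p ends o a₁ a₂)
      (prob p (avoidAll ends a₂ {a₁} ∩ connEvent ends a₁ o) +
        prob p (avoidAll ends a₂ {a₁} ∩ connEvent ends a₂ o))
      (prob p (avoidAll ends a₂ {a₁} ∩ connEvent ends a₁ b) +
        prob p (avoidAll ends a₂ {a₁} ∩ connEvent ends a₂ b))
      (prob p (avoidAll ends a₂ {a₁} ∩ (connEvent ends a₁ o ∩ connEvent ends a₁ b)) +
        prob p (avoidAll ends a₂ {a₁} ∩ (connEvent ends a₂ o ∩ connEvent ends a₁ b)) +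
        prob p (avoidAll ends a₂ {a₁} ∩ (connEvent ends a₁ o ∩ connEvent ends a₂ b)) +
        prob p (avoidAll ends a₂ {a₁} ∩ (connEvent ends a₂ o ∩ connEvent ends a₂ b)))
      (prob p (PDEvent ends a₁ a₂ u)) (Do p ends o a₁ a₂ u) (EQb3 p ends a₁ a₂ u b)
      (EQb3o p ends o a₁ a₂ u b) (EQ3 p ends a₁ a₂ u) (EQ3o p ends o a₁ a₂ u)
      (PDb p ends a₁ a₂ u b) (PDbo p ends o a₁ a₂ u b)
    have hr := add_nonneg (add_nonneg (mul_nonneg (mul_nonneg (mul_nonneg hQ hQ) hD.le) h₁)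
      (mul_nonneg (mul_nonneg (mul_nonneg hQ hQ) hQ) h₁))
      (mul_nonneg (mul_nonneg hQ hQ) (mul_nonneg hcov' hsl))
    rw [← key] at hr
    exact sub_nonneg.1 ((mul_nonneg_iff_of_pos_left hD).1 hr)

/-- **(SUB) at every pendant-PA edge of a mark-free instance, given (HCOV) at the open pin.** -/
theorem sub_of_pendantPA (p : E → R) (hp : IsProbVec p) {ends : E → Sym2 V} {o a₁ a₂ a₃ b : V}
    {e : E} (hpa : PendantPA p ends o a₁ a₂ a₃ e) (hf1 : p e ≠ 1)
    (hfree : MarkFree p ends o a₁ a₂ a₃ b)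
    (h₁ : HCov (Function.update p e 1) ends o a₁ a₂ a₃ b) :
    Sub1 p ends o a₁ a₂ a₃ b e ∧ Sub2 p ends o a₁ a₂ a₃ b e := by
  obtain ⟨hK, z, u, hends, hz, hu, hD, hcov⟩ := hpa
  exact sub_of_pendant p hp hK hends hz hu hf1 hfree.1 hfree.2.1 hfree.2.2.1 hfree.2.2.2 hD h₁
    hcov

end Pendant

end CPolarSubClasses

end Summit.Ventures.PercRepro2
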